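import Literature.Computability.FineGrained.NegativeTriangleToRadius
import Literature.Computability.FineGrained.RadiusToAPSP
import Literature.Computability.FineGrained.MinPlusToNegativeTriangleSweepProofs
import Literature.Computability.FineGrained.SubcubicEquivalencesAPSPTransProofs
import HarnessLib

/-!
# Fine-grained conjectures: APSP `≡₃` Radius (`fine-grained.S12`), discharged

Companion to `Literature.Computability.FineGrained.Conjectures` (theorems only): this file
**discharges the named fact `subcubicEquivalent_APSP_radius`** — Abboud–Grandoni–Vassilevska
Williams, *Subcubic equivalences between graph centrality problems, APSP and diameter*, SODA 2015,
Thm. 1.1: Radius of weighted digraphs and APSP (weights in `[-nᶜ, nᶜ]`) are subcubically equivalent,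
up to a polynomial change of the weight exponent (`SubcubicEquivalentFamily APSP Radius`). In print:
"One direction is trivial, and the other is given by Lemmas 2.1 and 2.3" — Lemma 2.1 being
APSP `≤₃` Negative Triangle (Vassilevska Williams–Williams) and Lemma 2.3 the radius gadget. Both
halves are verified word-RAM oracle programs landed in their own files, composed by the verified
transitivity of sub-cubic reductions:

* `radius_fgReducible_APSP` (`Literature.Computability.FineGrained.RadiusToAPSP`): Radius `≤₃` APSP
  by the program `RadiusToAPSP.prog` — one APSP query on the input matrix, then the fold
  `min_i max_j` through order keys; `c' = c`;
* `APSP_fgReducible_radius`: APSP `≤₃` Negative Triangle (`APSP_fgReducible_negativeTriangle_holds`,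
  VW–W 2018 Thm. 4.2 with `⌈log₂ n⌉` products, `Literature.Computability.FineGrained.MinPlusToNegativeTriangleSweepProofs`)
  `≤₃` Radius (`negativeTriangle_fgReducible_radius`, AGV Lemma 2.3 by the program
  `NegTriToRadius.prog` on the dense radius gadget, `Literature.Computability.FineGrained.NegativeTriangleToRadius`),
  composed by `fgReducible_pow_trans_of_sizeFitsWord_holds` (VW–W §3 Prop. 1, the verified inline
  simulation with query forwarding, `Literature.Computability.FineGrained.SubcubicEquivalencesAPSPTransProofs`)
  under the proved well-formedness of the three families (`APSP_isStandard`,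
  `NegativeTriangle_isStandard`, `Radius_isStandard`, `APSP_sizeFitsWord`).

The theorem lives here and not in `Conjectures` because the proof files import `Conjectures`
transitively.

## References

* A. Abboud, F. Grandoni, V. Vassilevska Williams, *Subcubic equivalences between graph centrality
  problems, APSP and diameter*, Proc. SODA 2015, 1681–1697, Thm. 1.1, Lemmas 2.1, 2.3.
  doi:10.1137/1.9781611973730.112
* V. Vassilevska Williams, R. R. Williams, *Subcubic equivalences between path, matrix, and triangle
  problems*, J. ACM 65 (2018), Art. 27, Thm. 1.1, Thm. 4.2, §3 Prop. 1. doi:10.1145/3186893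
-/

namespace Literature.Computability.FineGrained

open Cryptography

/-- **APSP `≤₃` Radius** (Abboud–Grandoni–Vassilevska Williams, SODA 2015, proof of Thm. 1.1:
"the other [direction] is given by Lemmas 2.1 and 2.3"): for every weight exponent `c` there is `c'`
and a subcubic fine-grained reduction from APSP with weights in `[-nᶜ, nᶜ]` to Radius with weights
in `[-N^{c'}, N^{c'}]` — APSP `≤₃` Negative Triangle `≤₃` Radius, composed by the transitivity of
sub-cubic reductions for well-formed families whose sizes fit in a word.
[cite: AbboudGrandoniVassilevskaWilliams2015, Thm. 1.1 (proof: Lemmas 2.1 and 2.3)] -/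
theorem APSP_fgReducible_radius (c : ℕ) :
    ∃ c' : ℕ, FGReducible (APSP c) (fun n => (n : ℝ) ^ (3 : ℝ)) (Radius c') (fun n => (n : ℝ) ^ (3 : ℝ)) := by
  obtain ⟨c₁, h₁⟩ := APSP_fgReducible_negativeTriangle_holds c
  obtain ⟨c₂, h₂⟩ := negativeTriangle_fgReducible_radius c₁
  exact ⟨c₂, fgReducible_pow_trans_of_sizeFitsWord_holds h₁ h₂ (APSP_isStandard c)
    (NegativeTriangle_isStandard c₁) (Radius_isStandard c₂) (APSP_sizeFitsWord c)⟩

/-- **Discharge of `subcubicEquivalent_APSP_radius`** (Abboud–Grandoni–Vassilevska Williams,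
SODA 2015, Thm. 1.1: "Radius … [is] equivalent to APSP under subcubic reductions"; VVW ICM 2018, §4
lists Radius among the problems subcubically equivalent to APSP): for every weight exponent there
are subcubic fine-grained reductions in both directions, all verified word-RAM oracle programs
(`APSP_fgReducible_radius`, `radius_fgReducible_APSP`).
[cite: AbboudGrandoniVassilevskaWilliams2015, Thm. 1.1] -/
theorem subcubicEquivalent_APSP_radius_holds : subcubicEquivalent_APSP_radius :=
  ⟨APSP_fgReducible_radius, radius_fgReducible_APSP⟩

/-- **APSP is truly subcubic for every weight exponent iff Radius is** (the printed consequence of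
Thm. 1.1, "a truly subcubic algorithm for any of them would imply one for APSP", in the corrected
word-RAM transfer form of `Conjectures`), unconditionally. [cite: AbboudGrandoniVassilevskaWilliams2015, Thm. 1.1] -/
theorem trulySubTime_APSP_iff_radius :
    (∀ c, (APSP c).TrulySubTime 3) ↔ ∀ c, (Radius c).TrulySubTime 3 :=
  SubcubicEquivalentFamily.trulySubTime_iff_of_sizeFitsWord_holds subcubicEquivalent_APSP_radius_holds
    APSP_isStandard Radius_isStandard APSP_sizeFitsWord Radius_sizeFitsWord

end Literature.Computability.FineGrained
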